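import Summits.Ventures.PercRepro2.CaseOneStarCertT1
import Summits.Ventures.PercRepro2.CaseOneGadgetUWA1BBlockI0
import Summits.Ventures.PercRepro2.CaseOneGadgetUWA1BBlockI1
import Summits.Ventures.PercRepro2.CaseOneGadgetUWA1BBlockI2
import Summits.Ventures.PercRepro2.CaseOneGadgetUWA1BBlockI3
import Summits.Ventures.PercRepro2.CaseOneGadgetUWA1BBlockI4
import Summits.Ventures.PercRepro2.CaseOneGadgetUWA1BBlockI5
import Summits.Ventures.PercRepro2.CaseOneGadgetUWA1BBlockI6
import Summits.Ventures.PercRepro2.CaseOneGadgetUWA1BBlockI7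
import Summits.Ventures.PercRepro2.CaseOneGadgetUWA1BBlockI8
import Summits.Ventures.PercRepro2.CaseOneGadgetUWA1BBlockI9
import Summits.Ventures.PercRepro2.CaseOneGadgetUWA1BBlockI10
import Summits.Ventures.PercRepro2.CaseOneGadgetUWA1BBlockI11
import Summits.Ventures.PercRepro2.CaseOneGadgetUWA1BBlockI12
import Summits.Ventures.PercRepro2.CaseOneGadgetUWA1BBlockI13
import Summits.Ventures.PercRepro2.CaseOneGadgetUWA1BBlockI14
import Summits.Ventures.PercRepro2.CaseOneStarFactsB

/-!
# The gadget `u ~ {w, a₁, b}`, `w ~ {u, a₂, o}` (uwa1b): the cell certificates of `iAB5` (part 42k)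
(blind cell PercRepro2, p1 g34; the fourth gadget anchor of the six-form calculus — all six forms of the uwa1b gadget
as plain SFacts-cone certificate chains, generated by mining/p1/g34/uwa1b/genu.py = p1 g33's gent_uwa1.py / g25's
geno.py re-targeted; P1-G33 §6–§6″, P1-G34)

Each `eBABI ijk kl` is a nonnegative combination of `(pairwise atom) × (cell)` and cubic cell monomials — or, for the degree-4 ones, `M × eBABI ijk kl` (`M = Σ cᵢ` the total cell mass) is a nonnegative combination of `(atom) × (cell) × (cell)` and quartic cell monomials, then `SFacts.nonneg_of_sum_mul` (`CaseOneStarCertT1`) — exact LP certificates (kit j319447, every certificate re-verified exactly; data/p1/g33/gcerts_i_uwa1b.json, form `i`), here as exact `linear_combination`s over `SFacts` (the rational coefficients cleared by their common denominator). -/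

namespace Summit.Ventures.PercRepro2

namespace CaseOne

section CertABI42k
variable {R : Type*} [Field R] [LinearOrder R] [IsStrictOrderedRing R]

set_option maxHeartbeats 0 in
/-- `eBABI33332 ≥ 0`: the combination is identically zero (`ring`). -/
lemma eBABI33332_nonneg (m : SCells R) (_hf : SFactsB m) : 0 ≤ eBABI33332 m := by
  have h : eBABI33332 m = 0 := by
    unfold eBABI33332 cBABI00132 cBABI00232 cBABI01032 cBABI01132 cBABI01232 cBABI01332 cBABI02032 cBABI02132 cBABI02232 cBABI02332 cBABI03132 cBABI03232 cBABI03332 cBABI10132 cBABI10232 cBABI11032 cBABI11132 cBABI11232 cBABI11332 cBABI12032 cBABI12132 cBABI12232 cBABI12332 cBABI13032 cBABI13132 cBABI13232 cBABI13332 cBABI20132 cBABI20232 cBABI21032 cBABI21132 cBABI21232 cBABI21332 cBABI22032 cBABI22132 cBABI22232 cBABI22332 cBABI23032 cBABI23132 cBABI23232 cBABI23332 cBABI31132 cBABI31232 cBABI31332 cBABI32032 cBABI32132 cBABI32232 cBABI32332 cBABI33032 cBABI33132 cBABI33232 cBABI33332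
    ring
  linarith [h]

end CertABI42k

end CaseOne

end Summit.Ventures.PercRepro2
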